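import Literature.NumberTheory.DiophantineGeometry.KroneckerSemigroup
import HarnessLib

/-!
# Monotonicity of the Kronecker coefficients under the semigroup operation

For partitions `λ, μ, ν ⊢ a` and `λ', μ', ν' ⊢ b` with `g(λ', μ', ν') > 0`:
**`g(λ, μ, ν) ≤ g(λ + λ', μ + μ', ν + ν')`** (row-wise sums), over any field of characteristic zero
(`kroneckerCoeff_le_of_ofPartition_add`).  This sharpens the semigroup property
`g, g' > 0 ⇒ g(sum) > 0` of the companion file `KroneckerSemigroup.lean`
(`kroneckerCoeff_pos_of_ofPartition_add`, Christandl–Harrow–Mitchison 2007) to the MONOTONICITY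
stated by Manivel ("if `g(α, β, γ) ≠ 0` then `g(λ + α, μ + β, ν + γ) ≥ g(λ, μ, ν)`", J. Algebraic
Combin. 33 (2011), §1; also Christandl–Harrow–Mitchison, Comm. Math. Phys. 270 (2007), and the
"three properties" of Ikenmeyer–Panova, Adv. Math. 319 (2017) §1.1, whose one-line proof —
multiplying highest-weight vectors — gives monotonicity verbatim: multiplication by ONE nonzero
highest-weight vector of weight `(λ', μ', ν')` is injective).

## Proof (in the word model of `KroneckerSemigroup.lean`)

`g(λ, μ, ν)` is the dimension of the `S_a`-invariants of the triple slice space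
`HW_λ ⊗ HW_μ ⊗ HW_ν ⊆ k^{W_a × W_a × W_a}` (`finrank_invariants_tripleHwRep`).  Fix a nonzero invariant
`M' ∈ HW_{λ'} ⊗ HW_{μ'} ⊗ HW_{ν'}` (`exists_invariant_of_kroneckerCoeff_pos`).  The map
`M ↦ ∑_{τ ∈ S_{a+b}} τ · (M ⊙ M')` (symmetrised concatenation product, `sym3 ∘ concat3 · M'`) is LINEAR
in `M`, maps invariant triple tensors of weight `(λ, μ, ν)` to invariant triple tensors of weight
`(λ+λ', μ+μ', ν+ν')` (`concat3_mem_tripleHw`, `sym3_mem_tripleHw`, `sym3_permute3`), and is INJECTIVE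
on invariant tensors: a nonzero invariant `M` has `∑_τ τ · (M ⊙ M') ≠ 0` (`sym3_concat3_ne_zero`,
the polynomial ring being a domain).  Hence the inequality of dimensions
(`finrank_invariants_tripleHwRep_le_of_invariant`).

## References

* L. Manivel, *On rectangular Kronecker coefficients*, J. Algebraic Combin. 33 (2011) 153–162 =
  arXiv:0907.3351, §1 (monotonicity). [key `Manivel2011`]
* M. Christandl, A. W. Harrow, G. Mitchison, Comm. Math. Phys. 270 (2007) 575–585.
* C. Ikenmeyer, G. Panova, Adv. Math. 319 (2017) 40–66 = arXiv:1512.03798, §1.1.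
  [key `IkenmeyerPanova2017`]

Mathlib: `LinearMap.finrank_le_finrank_of_injective`, `Submodule.map`, `LinearMap.codRestrict`,
`LinearMap.domRestrict`.  Tree: everything of `KroneckerSemigroup.lean` §3–§5.  Theorems only.
-/

noncomputable section

open scoped BigOperators

namespace Literature.NumberTheory.DiophantineGeometry

variable {k : Type*} [Field k] {N a b : ℕ}

/-- An invariant vector of the triple slice representation, read as a function on triples of words,
is invariant under the diagonal position action. [folklore] -/
theorem permute3_coe_of_mem_invariants {n : ℕ} {χ₁ χ₂ χ₃ : Weight (Fin N)}
    {x : tripleHw k N n χ₁ χ₂ χ₃} (hx : x ∈ (tripleHwRep k N n χ₁ χ₂ χ₃).invariants)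
    (τ : Equiv.Perm (Fin n)) (t : Word3 N n) :
    (x : Word3 N n → k) (permute3 τ t) = (x : Word3 N n → k) t := by
  have hinv := (Representation.mem_invariants _ _).1 hx τ
  have := congrArg (fun y : tripleHw k N n χ₁ χ₂ χ₃ => (y : Word3 N n → k) t) hinv
  rwa [coe_tripleHwRep_apply] at this

/-- A function in the triple slice space that is invariant under the diagonal position action is (the
coercion of) an invariant vector of the triple slice representation. [folklore] -/
theorem mem_map_subtype_invariants_of_permute3 {n : ℕ} {χ₁ χ₂ χ₃ : Weight (Fin N)}
    {M : Word3 N n → k} (hM : M ∈ tripleHw k N n χ₁ χ₂ χ₃) (hinv : ∀ τ t, M (permute3 τ t) = M t) :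
    M ∈ (tripleHwRep k N n χ₁ χ₂ χ₃).invariants.map (tripleHw k N n χ₁ χ₂ χ₃).subtype := by
  refine ⟨⟨M, hM⟩, ?_, rfl⟩
  rw [SetLike.mem_coe, Representation.mem_invariants]
  intro τ
  apply Subtype.ext
  funext t
  rw [coe_tripleHwRep_apply]
  exact hinv τ t

/-- **Multiplication by a nonzero invariant triple tensor is injective on invariant triple tensors**:
if `M' ≠ 0` is an `S_b`-invariant element of `HW_{ψ₁} ⊗ HW_{ψ₂} ⊗ HW_{ψ₃}` (length `b`), then
`dim (HW_{χ₁} ⊗ HW_{χ₂} ⊗ HW_{χ₃})^{S_a} ≤ dim (HW_{χ₁+ψ₁} ⊗ HW_{χ₂+ψ₂} ⊗ HW_{χ₃+ψ₃})^{S_{a+b}}`, the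
injective linear map being `M ↦ ∑_τ τ · (M ⊙ M')` (`sym3_concat3_ne_zero`).
[cite: Manivel2011, §1 (monotonicity of Kronecker coefficients)] -/
theorem finrank_invariants_tripleHwRep_le_of_invariant [CharZero k] {χ₁ χ₂ χ₃ ψ₁ ψ₂ ψ₃ : Weight (Fin N)}
    {M' : Word3 N b → k} (hM'mem : M' ∈ tripleHw k N b ψ₁ ψ₂ ψ₃) (hM'0 : M' ≠ 0)
    (hM'inv : ∀ τ t, M' (permute3 τ t) = M' t) :
    Module.finrank k (tripleHwRep k N a χ₁ χ₂ χ₃).invariants ≤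
      Module.finrank k (tripleHwRep k N (a + b) (χ₁ + ψ₁) (χ₂ + ψ₂) (χ₃ + ψ₃)).invariants := by
  classical
  set SV : Submodule k (Word3 N a → k) :=
    (tripleHwRep k N a χ₁ χ₂ χ₃).invariants.map (tripleHw k N a χ₁ χ₂ χ₃).subtype with hSV
  set SW : Submodule k (Word3 N (a + b) → k) :=
    (tripleHwRep k N (a + b) (χ₁ + ψ₁) (χ₂ + ψ₂) (χ₃ + ψ₃)).invariants.map
      (tripleHw k N (a + b) (χ₁ + ψ₁) (χ₂ + ψ₂) (χ₃ + ψ₃)).subtype with hSW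
  -- reading invariant vectors as functions does not change dimensions
  have hV : Module.finrank k (tripleHwRep k N a χ₁ χ₂ χ₃).invariants = Module.finrank k SV :=
    (LinearEquiv.finrank_eq (Submodule.equivMapOfInjective _ (Submodule.injective_subtype _) _))
  have hW : Module.finrank k (tripleHwRep k N (a + b) (χ₁ + ψ₁) (χ₂ + ψ₂) (χ₃ + ψ₃)).invariants =
      Module.finrank k SW :=
    (LinearEquiv.finrank_eq (Submodule.equivMapOfInjective _ (Submodule.injective_subtype _) _))
  rw [hV, hW]
  -- the symmetrised multiplication by `M'`, a linear map on functions
  let φ : (Word3 N a → k) →ₗ[k] (Word3 N (a + b) → k) :=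
    { toFun := fun M => sym3 (concat3 M M')
      map_add' := fun M₁ M₂ => by
        funext t
        simp only [sym3, concat3, Pi.add_apply, add_mul, Finset.sum_add_distrib]
      map_smul' := fun c M => by
        funext t
        simp only [sym3, concat3, Pi.smul_apply, smul_eq_mul, RingHom.id_apply, Finset.mul_sum,
          mul_assoc] }
  have hφ : ∀ M, φ M = sym3 (concat3 M M') := fun M => rfl
  -- `φ` maps `SV` into `SW`
  have hmap : ∀ M ∈ SV, φ M ∈ SW := by
    rintro M ⟨x, hx, rfl⟩
    rw [hφ]
    exact mem_map_subtype_invariants_of_permute3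
      (sym3_mem_tripleHw (concat3_mem_tripleHw x.2 hM'mem)) (fun τ t => sym3_permute3 _ τ t)
  -- and is injective on `SV`
  have hinj : ∀ M ∈ SV, φ M = 0 → M = 0 := by
    rintro M ⟨x, hx, rfl⟩ h0
    by_contra hne
    exact sym3_concat3_ne_zero (permute3_coe_of_mem_invariants hx) hM'inv hne hM'0 ((hφ _).symm.trans h0)
  -- the restricted map `SV → SW`
  let ψ : SV →ₗ[k] SW := LinearMap.codRestrict SW (φ.domRestrict SV) fun M => hmap M.1 M.2
  have hψ : Function.Injective ψ := by
    intro M₁ M₂ h12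
    have h := congrArg (fun y : SW => (y : Word3 N (a + b) → k)) h12
    simp only [ψ, LinearMap.codRestrict_apply, LinearMap.domRestrict_apply] at h
    have hsub : φ ((M₁ : Word3 N a → k) - M₂) = 0 := by rw [map_sub, h, sub_self]
    have := hinj _ (SV.sub_mem M₁.2 M₂.2) hsub
    exact Subtype.ext (sub_eq_zero.mp this)
  exact LinearMap.finrank_le_finrank_of_injective hψ

/-- **Monotonicity of the Kronecker coefficients** (Manivel 2011 §1; Christandl–Harrow–Mitchison 2007):
for `λ, μ, ν ⊢ a` and `λ', μ', ν' ⊢ b` with `g(λ', μ', ν') > 0`, the row-wise sums `Λ, Μ, Ν ⊢ a + b`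
(specified by `ofPartition N Λ = ofPartition N λ + ofPartition N λ'` etc., `N` bounding the number of
parts of all nine partitions) satisfy **`g(λ, μ, ν) ≤ g(Λ, Μ, Ν)`**.  Proof: `g` is the dimension of the
invariant triple highest-weight tensors (`finrank_invariants_tripleHwRep`), and multiplication by a
nonzero invariant tensor of weight `(λ', μ', ν')` (`exists_invariant_of_kroneckerCoeff_pos`) is
injective (`finrank_invariants_tripleHwRep_le_of_invariant`).
[cite: Manivel2011, §1 (monotonicity: "if g(α,β,γ) ≠ 0 then g(λ+α, μ+β, ν+γ) ≥ g(λ, μ, ν)")] -/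
theorem kroneckerCoeff_le_of_ofPartition_add [CharZero k] {a b : ℕ} (N : ℕ)
    {lam mu nu : Nat.Partition a} {lam' mu' nu' : Nat.Partition b}
    {Lam Mu Nu : Nat.Partition (a + b)}
    (hl : lam.parts.card ≤ N) (hm : mu.parts.card ≤ N) (hn : nu.parts.card ≤ N)
    (hl' : lam'.parts.card ≤ N) (hm' : mu'.parts.card ≤ N) (hn' : nu'.parts.card ≤ N)
    (hL : Lam.parts.card ≤ N) (hM : Mu.parts.card ≤ N) (hN : Nu.parts.card ≤ N)
    (eL : Weight.ofPartition N Lam = Weight.ofPartition N lam + Weight.ofPartition N lam')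
    (eM : Weight.ofPartition N Mu = Weight.ofPartition N mu + Weight.ofPartition N mu')
    (eN : Weight.ofPartition N Nu = Weight.ofPartition N nu + Weight.ofPartition N nu')
    (h' : 0 < kroneckerCoeff k lam' mu' nu') :
    kroneckerCoeff k lam mu nu ≤ kroneckerCoeff k Lam Mu Nu := by
  obtain ⟨M', hMmem', hM0', hMinv'⟩ :=
    exists_invariant_of_kroneckerCoeff_pos (k := k) hl' hm' hn' h'
  rw [← finrank_invariants_tripleHwRep (k := k) lam mu nu hl hm hn,
    ← finrank_invariants_tripleHwRep (k := k) Lam Mu Nu hL hM hN, eL, eM, eN]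
  exact finrank_invariants_tripleHwRep_le_of_invariant hMmem' hM0' hMinv'

end Literature.NumberTheory.DiophantineGeometry
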